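import Summits.Parity.GeneralizedHardyLittlewood.Theorems.PrimeLevelFamEdgeMomentsBeyondDiagonalDiagDecorWeightOneOne
import HarnessLib

/-!
# Route `PrimeLevelFamEdge`, crux K_A `MomentsBeyondDiagonal` (stmt-Parity-20007), line «petersson_layers» v4, stub `stub_diag`:
# **the GENERIC-ORDER weight algebra: the Hecke-divisor sums `Σ_{d∣k₁}Σ_{e∣k₂} A₁^p A₂^q` for ALL `(p,q)` in closed,
# SEPARABLE form via the central divisor-log moments `M_t(k) = Σ_{d∣k}(2log d − log k)^t`**

Census item «GENERIC (i,j): new inputs = `Σ_{d,e}A₁^pA₂^q` for `p,q ≤ i,j`» of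
`Cruxes/MomentsBeyondDiagonal/Lines/petersson_layers_stub_diag_g10_blocks.md`. In the decorated Selberg coordinates of
`…DiagOrderSelberg` the order-`(i,j)` weight is, after `…DiagOrderSplit.selbergForm_bose_expand`,
`Σ_{a≤i,b≤j} C(i,a)C(j,b)·A₁^{i−a}A₂^{j−b}·c_{ab}(n₁n₂/Q²)` with `A₁ = log(Q/n₁) = X − log e − log(k₁/d)`,
`A₂ = log(Q/n₂) = X − log d − log(k₂/e)`, `X = log Q − log g`, `n₁n₂ = g²k₁k₂` (`…DiagDecorWeightOneOne`, which does the four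
sums with `p, q ≤ 1`). Here ALL the sums `Σ_{d,e}A₁^pA₂^q` are evaluated at once by the SYMMETRISATION

  `A₁ = (L + δ)/2`, `A₂ = (L − δ)/2`, `L = A₁ + A₂ = 2X − log k₁ − log k₂` ((d,e)-free),
  `δ = A₁ − A₂ = s_{k₁}(d) − s_{k₂}(e)`, `s_k(d) = 2log d − log k` (ANTISYMMETRIC under the divisor involution `d ↦ k/d`):

* `A1_eq_half_L_add_delta`, `A2_eq_half_L_sub_delta` — the symmetrisation, pointwise in `(d,e)`;
* `half_add_pow_mul_half_sub_pow` — `((L+δ)/2)^p((L−δ)/2)^q = 2^{−(p+q)}Σ_{i≤p}Σ_{j≤q}C(p,i)C(q,j)(−1)^jL^{p+q−i−j}δ^{i+j}`;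
* `sum_divisors_sum_divisors_A1_pow_mul_A2_pow` — **`Σ_{d,e}A₁^pA₂^q =
  2^{−(p+q)} Σ_{i≤p}Σ_{j≤q} C(p,i)C(q,j)(−1)^j L^{p+q−i−j} · J_{i+j}(k₁,k₂)`**, `J_s(k₁,k₂) = Σ_{d,e}δ^s` (joint moments);
* `sum_divisors_sum_divisors_delta_pow` / `…_eq` — **SEPARATION `J_s(k₁,k₂) = Σ_{t≤s} C(s,t)·M_t(k₁)·M_{s−t}(k₂)`**
  (binomial theorem in `δ = s_{k₁}(d) − s_{k₂}(e)`, the sign `(−1)^{s−t}` being absorbed by `M_odd = 0`);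
  `sum_divisors_sum_divisors_delta_pow_eq_zero_of_odd` — `J_s = 0` for odd `s`;
* `sum_divisors_sum_divisors_A1_pow_mul_A2_pow_eq` — **the separable closed form
  `Σ_{d,e}A₁^pA₂^q = 2^{−(p+q)} Σ_{i≤p}Σ_{j≤q} C(p,i)C(q,j)(−1)^j L^{p+q−i−j} Σ_{t≤i+j} C(i+j,t) M_t(k₁)M_{i+j−t}(k₂)`**;
* `inner_weight_A1_pow_A2_pow` — the same with an arbitrary `(d,e)`-free factor `H(n₁n₂)` in the Selberg variables
  `n₁ = (k₁/d)(ge)`, `n₂ = (gd)(k₂/e)` (the format of `…DiagDecorWeightOneOne.inner_weight_*`);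
* the moments: `centralMoment_swap` (`Σ_{d∣k}(log k − 2log d)^t = M_t(k)`), `centralMoment_eq_zero_of_odd` (**`M_t = 0` for odd
  `t`, every `k`**), `centralMoment_zero` (`M_0 = τ`), `centralMoment_one` (`M_1 = 0`), `centralMoment_prime`
  (`M_t(p) = (−log p)^t + (log p)^t`), `centralMoment_mul_of_coprime` (**binomial multiplicativity
  `M_t(mn) = Σ_{j≤t} C(t,j) M_j(m) M_{t−j}(n)`** for coprime `m,n`), `centralMoment_two_of_squarefree`
  (**`M_2(k) = τ(k)·P₂(k)`**, `P₂(k) = Σ_{p∣k}log²p`, squarefree `k`);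
* checks: `sum_divisors_sum_divisors_A1_sq_of_squarefree` — **`Σ_{d,e}A₁² = τ(k₁)τ(k₂)(L²/4 + (P₂(k₁)+P₂(k₂))/4)`**
  (the example of the g10 census), and an `example` checks that `(p,q) = (1,1)` re-derives the landed `…A1_mul_A2_of_squarefree`.

So every order's Hecke-summed polynomial weight is a combination of the SEPARABLE monomials `M_t(k₁)·M_{t′}(k₂)·L^m`
(`t, t′` even), i.e. of two-sided decorated β+ℓ⁺ blocks (`…DiagDecorShiftedBlockDecor*`); on squarefree `k` the
decorations are `M_0 = τ`, `M_2 = τP₂`, `M_4 = τ(3P₂² − 2P₄)`, … (cumulants of `Σ_{p∣k} ±log p`; generating function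
`Σ_{d∣k}(d²/k)^z = Π_{p∣k}(p^z + p^{−z})`). Exact identities only (no asymptotics); valid for all `k₁, k₂` (both sides vanish
at `k = 0`). Def-free; theorems only. Helper `--supports stmt-Parity-20007`; closes nothing; K_A, K_B and the Parity summit
are NOT proved; nothing about Landau–Siegel zeros.

## References
* E. Kowalski, P. Michel, J. VanderKam, J. reine angew. Math. 526 (2000), (23)–(28) pp. 13–15.
  [cite: KowalskiMichelVanderKam2000, (23)–(28) — derivation (Hecke-divisor bookkeeping of the order-(i,j) diagonal weight)]
-/

noncomputable section

open scoped Real ArithmeticFunction.Moebius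
open Finset ArithmeticFunction Polynomial

namespace Summit.Parity.GeneralizedHardyLittlewood.Theorems.MomentsBeyondDiagonal.DiagKernel

open Literature.NumberTheory.LFunctions Literature.NumberTheory.LFunctions.KMV2000
open Summit.Parity.GeneralizedHardyLittlewood.Theorems.MomentsBeyondDiagonal.DiagLines
  (sum_divisors_log_eq tau11_eq_of_squarefree sum_divisors_mul_eq_sum_sum_of_coprime)

/-! ### Finite-sum plumbing -/

/-- Four nested finite sums: the two outer ones move past the two inner ones. [folklore] -/
private theorem sum_sum_sum_sum_comm {α β γ δ : Type*} (A : Finset α) (B : Finset β) (C : Finset γ) (D : Finset δ)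
    (F : α → β → γ → δ → ℝ) :
    ∑ a ∈ A, ∑ b ∈ B, ∑ c ∈ C, ∑ d ∈ D, F a b c d = ∑ c ∈ C, ∑ d ∈ D, ∑ a ∈ A, ∑ b ∈ B, F a b c d := by
  calc ∑ a ∈ A, ∑ b ∈ B, ∑ c ∈ C, ∑ d ∈ D, F a b c d
      = ∑ a ∈ A, ∑ c ∈ C, ∑ b ∈ B, ∑ d ∈ D, F a b c d := Finset.sum_congr rfl fun _ _ ↦ Finset.sum_comm
    _ = ∑ c ∈ C, ∑ a ∈ A, ∑ b ∈ B, ∑ d ∈ D, F a b c d := Finset.sum_comm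
    _ = ∑ c ∈ C, ∑ a ∈ A, ∑ d ∈ D, ∑ b ∈ B, F a b c d :=
        Finset.sum_congr rfl fun _ _ ↦ Finset.sum_congr rfl fun _ _ ↦ Finset.sum_comm
    _ = ∑ c ∈ C, ∑ d ∈ D, ∑ a ∈ A, ∑ b ∈ B, F a b c d := Finset.sum_congr rfl fun _ _ ↦ Finset.sum_comm

/-- Three nested finite sums: the two outer ones move past the inner one. [folklore] -/
private theorem sum_sum_sum_comm {α β γ : Type*} (A : Finset α) (B : Finset β) (C : Finset γ) (F : α → β → γ → ℝ) :
    ∑ a ∈ A, ∑ b ∈ B, ∑ c ∈ C, F a b c = ∑ c ∈ C, ∑ a ∈ A, ∑ b ∈ B, F a b c := by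
  calc ∑ a ∈ A, ∑ b ∈ B, ∑ c ∈ C, F a b c
      = ∑ a ∈ A, ∑ c ∈ C, ∑ b ∈ B, F a b c := Finset.sum_congr rfl fun _ _ ↦ Finset.sum_comm
    _ = ∑ c ∈ C, ∑ a ∈ A, ∑ b ∈ B, F a b c := Finset.sum_comm

/-! ### Central divisor-log moments `M_t(k) = Σ_{d∣k}(2log d − log k)^t` -/

/-- `Σ_{d∣k}(log k − 2log d)^t = Σ_{d∣k}(2log d − log k)^t` (the divisor involution `d ↦ k/d`). [folklore] -/
theorem centralMoment_swap (t k : ℕ) :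
    ∑ d ∈ k.divisors, (Real.log k - 2 * Real.log d) ^ t = ∑ d ∈ k.divisors, (2 * Real.log d - Real.log k) ^ t := by
  rw [← Nat.sum_div_divisors k (fun d ↦ (2 * Real.log (d : ℝ) - Real.log k) ^ t)]
  refine Finset.sum_congr rfl fun d hd ↦ ?_
  rw [← log_add_log_div_of_mem_divisors hd]
  ring

/-- **`M_t(k) = 0` for odd `t`** (every `k`): the summand is odd under `d ↦ k/d`. [folklore] -/
theorem centralMoment_eq_zero_of_odd {t : ℕ} (ht : Odd t) (k : ℕ) :
    ∑ d ∈ k.divisors, (2 * Real.log d - Real.log k) ^ t = 0 := by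
  have h := centralMoment_swap t k
  have h2 : ∑ d ∈ k.divisors, (Real.log k - 2 * Real.log d) ^ t =
      -∑ d ∈ k.divisors, (2 * Real.log d - Real.log k) ^ t := by
    rw [← Finset.sum_neg_distrib]
    refine Finset.sum_congr rfl fun d _ ↦ ?_
    rw [show Real.log k - 2 * Real.log d = -(2 * Real.log d - Real.log k) by ring, ht.neg_pow]
  linarith

/-- `M_0(k) = τ(k)`. [folklore] -/
theorem centralMoment_zero (k : ℕ) :
    ∑ d ∈ k.divisors, (2 * Real.log d - Real.log k) ^ 0 = (k.divisors.card : ℝ) := by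
  simp

/-- `M_1(k) = 0`. [folklore] -/
theorem centralMoment_one (k : ℕ) : ∑ d ∈ k.divisors, (2 * Real.log d - Real.log k) ^ 1 = 0 :=
  centralMoment_eq_zero_of_odd odd_one k

/-- `M_t(p) = (−log p)^t + (log p)^t` for a prime `p` (divisors `1, p`). [folklore] -/
theorem centralMoment_prime (t : ℕ) {p : ℕ} (hp : p.Prime) :
    ∑ d ∈ p.divisors, (2 * Real.log d - Real.log p) ^ t = (-Real.log p) ^ t + Real.log p ^ t := by
  rw [hp.divisors, Finset.sum_pair hp.one_lt.ne]
  push_cast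
  rw [Real.log_one]
  ring

/-- **Binomial multiplicativity of the central moments**: for coprime `m, n ≥ 1`,
`M_t(mn) = Σ_{j≤t} C(t,j)·M_j(m)·M_{t−j}(n)` (`s_{mn}(ab) = s_m(a) + s_n(b)` on `a ∣ m`, `b ∣ n`). [folklore] -/
theorem centralMoment_mul_of_coprime (t : ℕ) {m n : ℕ} (hm : m ≠ 0) (hn : n ≠ 0) (hmn : m.Coprime n) :
    ∑ d ∈ (m * n).divisors, (2 * Real.log d - Real.log ((m * n : ℕ) : ℝ)) ^ t =
      ∑ j ∈ range (t + 1), (t.choose j : ℝ) *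
        ((∑ a ∈ m.divisors, (2 * Real.log a - Real.log m) ^ j) *
          ∑ b ∈ n.divisors, (2 * Real.log b - Real.log n) ^ (t - j)) := by
  have h := sum_divisors_mul_eq_sum_sum_of_coprime hmn (fun d _ ↦ (2 * Real.log d - Real.log ((m * n : ℕ) : ℝ)) ^ t)
  beta_reduce at h
  rw [h]
  -- pointwise binomial expansion
  have hpt : ∀ a ∈ m.divisors, ∀ b ∈ n.divisors,
      (2 * Real.log ((a * b : ℕ) : ℝ) - Real.log ((m * n : ℕ) : ℝ)) ^ t =
        ∑ j ∈ range (t + 1), (t.choose j : ℝ) *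
          ((2 * Real.log a - Real.log m) ^ j * (2 * Real.log b - Real.log n) ^ (t - j)) := by
    intro a ha b hb
    have ha' := (Nat.mem_divisors.1 ha).1
    have hb' := (Nat.mem_divisors.1 hb).1
    have ha0 : a ≠ 0 := by rintro rfl; exact hm (zero_dvd_iff.1 ha')
    have hb0 : b ≠ 0 := by rintro rfl; exact hn (zero_dvd_iff.1 hb')
    push_cast
    rw [Real.log_mul (by exact_mod_cast ha0) (by exact_mod_cast hb0),
      Real.log_mul (by exact_mod_cast hm) (by exact_mod_cast hn),
      show 2 * (Real.log a + Real.log b) - (Real.log m + Real.log n) =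
        (2 * Real.log a - Real.log m) + (2 * Real.log b - Real.log n) by ring, add_pow]
    exact Finset.sum_congr rfl fun j _ ↦ by ring
  rw [Finset.sum_congr rfl fun a ha ↦ Finset.sum_congr rfl fun b hb ↦ hpt a ha b hb, sum_sum_sum_comm]
  refine Finset.sum_congr rfl fun j _ ↦ ?_
  rw [Finset.sum_mul_sum, Finset.mul_sum]
  exact Finset.sum_congr rfl fun a _ ↦ by rw [Finset.mul_sum]

/-- **`M_2 = τ·P₂` on squarefree numbers**: `Σ_{d∣k}(2log d − log k)² = τ(k)·Σ_{p∣k}log²p` for squarefree `k`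
(variance of `Σ_{p∣k} ±log p`). [folklore] -/
theorem centralMoment_two_of_squarefree {k : ℕ} (hk : Squarefree k) :
    ∑ d ∈ k.divisors, (2 * Real.log d - Real.log k) ^ 2 =
      (k.divisors.card : ℝ) * ∑ p ∈ k.primeFactors, Real.log p ^ 2 := by
  induction k using Nat.recOnPosPrimePosCoprime with
  | zero => exact absurd hk not_squarefree_zero
  | one => simp
  | prime_pow p n hp hn =>
    have hn1 : n = 1 := ((Nat.squarefree_pow_iff hp.ne_one hn.ne').1 hk).2
    subst hn1
    rw [pow_one, centralMoment_prime 2 hp, hp.divisors, Finset.card_pair hp.one_lt.ne, hp.primeFactors,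
      Finset.sum_singleton]
    ring
  | coprime a b ha hb hab iha ihb =>
    have hsq := Nat.squarefree_mul_iff.1 hk
    have ha0 : a ≠ 0 := by omega
    have hb0 : b ≠ 0 := by omega
    have hmul := centralMoment_mul_of_coprime 2 ha0 hb0 hab
    push_cast at hmul ⊢
    rw [hmul]
    simp only [Finset.sum_range_succ, Finset.sum_range_zero, zero_add, Nat.sub_self, Nat.sub_zero,
      iha hsq.2.1, ihb hsq.2.2, centralMoment_one, centralMoment_zero]
    rw [Nat.Coprime.card_divisors_mul hab, Nat.Coprime.primeFactors_mul hab,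
      Finset.sum_union (Nat.Coprime.disjoint_primeFactors hab)]
    push_cast
    norm_num [Nat.choose]
    ring

/-! ### The symmetrisation `A₁ = (L + δ)/2`, `A₂ = (L − δ)/2` -/

/-- `A₁ = X − log e − log(k₁/d) = (L + δ)/2` with `L = 2X − log k₁ − log k₂`,
`δ = (2log d − log k₁) − (2log e − log k₂)` (`d ∣ k₁`). [folklore] -/
theorem A1_eq_half_L_add_delta (X : ℝ) {k₁ d : ℕ} (k₂ e : ℕ) (hd : d ∈ k₁.divisors) :
    X - Real.log e - Real.log ((k₁ / d : ℕ) : ℝ) =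
      ((2 * X - Real.log k₁ - Real.log k₂) +
        ((2 * Real.log d - Real.log k₁) - (2 * Real.log e - Real.log k₂))) / 2 := by
  rw [← log_add_log_div_of_mem_divisors hd]
  ring

/-- `A₂ = X − log d − log(k₂/e) = (L − δ)/2` with `L = 2X − log k₁ − log k₂`,
`δ = (2log d − log k₁) − (2log e − log k₂)` (`e ∣ k₂`). [folklore] -/
theorem A2_eq_half_L_sub_delta (X : ℝ) (k₁ d : ℕ) {k₂ e : ℕ} (he : e ∈ k₂.divisors) :
    X - Real.log d - Real.log ((k₂ / e : ℕ) : ℝ) =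
      ((2 * X - Real.log k₁ - Real.log k₂) -
        ((2 * Real.log d - Real.log k₁) - (2 * Real.log e - Real.log k₂))) / 2 := by
  rw [← log_add_log_div_of_mem_divisors he]
  ring

/-- **`((L+δ)/2)^p·((L−δ)/2)^q = 2^{−(p+q)}·Σ_{i≤p}Σ_{j≤q} C(p,i)C(q,j)(−1)^j·L^{(p−i)+(q−j)}·δ^{i+j}`** (two binomial
theorems). [folklore] -/
theorem half_add_pow_mul_half_sub_pow (L δ : ℝ) (p q : ℕ) :
    ((L + δ) / 2) ^ p * ((L - δ) / 2) ^ q =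
      (1 / 2) ^ (p + q) * ∑ i ∈ range (p + 1), ∑ j ∈ range (q + 1),
        (p.choose i : ℝ) * (q.choose j) * (-1) ^ j * L ^ (p - i + (q - j)) * δ ^ (i + j) := by
  have h1 : ((L + δ) / 2) ^ p = (1 / 2) ^ p * (δ + L) ^ p := by rw [← mul_pow]; ring
  have h2 : ((L - δ) / 2) ^ q = (1 / 2) ^ q * (-δ + L) ^ q := by rw [← mul_pow]; ring
  rw [h1, h2, add_pow, add_pow, pow_add,
    show (1 / 2 : ℝ) ^ p * (∑ i ∈ range (p + 1), δ ^ i * L ^ (p - i) * (p.choose i : ℝ)) *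
        ((1 / 2) ^ q * ∑ j ∈ range (q + 1), (-δ) ^ j * L ^ (q - j) * (q.choose j : ℝ)) =
      (1 / 2) ^ p * (1 / 2) ^ q * ((∑ i ∈ range (p + 1), δ ^ i * L ^ (p - i) * (p.choose i : ℝ)) *
        ∑ j ∈ range (q + 1), (-δ) ^ j * L ^ (q - j) * (q.choose j : ℝ)) by ring,
    Finset.sum_mul_sum]
  congr 1
  refine Finset.sum_congr rfl fun i _ ↦ Finset.sum_congr rfl fun j _ ↦ ?_
  rw [neg_pow, pow_add, pow_add]
  ring

/-! ### The generic two-variable Hecke-divisor sums -/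

/-- **Structure theorem: `Σ_{d∣k₁}Σ_{e∣k₂} A₁^p A₂^q =
2^{−(p+q)} Σ_{i≤p}Σ_{j≤q} C(p,i)C(q,j)(−1)^j L^{(p−i)+(q−j)} · J_{i+j}(k₁,k₂)`** with `A₁ = X − log e − log(k₁/d)`,
`A₂ = X − log d − log(k₂/e)`, `L = 2X − log k₁ − log k₂` and the joint moments
`J_s(k₁,k₂) = Σ_{d,e}((2log d − log k₁) − (2log e − log k₂))^s` (every `k₁, k₂, p, q`).
[cite: KowalskiMichelVanderKam2000, (23)–(28) — derivation] -/
theorem sum_divisors_sum_divisors_A1_pow_mul_A2_pow (X : ℝ) (p q k₁ k₂ : ℕ) :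
    ∑ d ∈ k₁.divisors, ∑ e ∈ k₂.divisors,
        (X - Real.log e - Real.log ((k₁ / d : ℕ) : ℝ)) ^ p * (X - Real.log d - Real.log ((k₂ / e : ℕ) : ℝ)) ^ q =
      (1 / 2) ^ (p + q) * ∑ i ∈ range (p + 1), ∑ j ∈ range (q + 1),
        (p.choose i : ℝ) * (q.choose j) * (-1) ^ j * (2 * X - Real.log k₁ - Real.log k₂) ^ (p - i + (q - j)) *
          ∑ d ∈ k₁.divisors, ∑ e ∈ k₂.divisors,
            ((2 * Real.log d - Real.log k₁) - (2 * Real.log e - Real.log k₂)) ^ (i + j) := by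
  -- pointwise symmetrisation and binomial expansion
  rw [Finset.sum_congr rfl fun d hd ↦ Finset.sum_congr rfl fun e he ↦ by
    rw [A1_eq_half_L_add_delta X k₂ e hd, A2_eq_half_L_sub_delta X k₁ d he, half_add_pow_mul_half_sub_pow]]
  simp_rw [← Finset.mul_sum]
  congr 1
  rw [sum_sum_sum_sum_comm]
  refine Finset.sum_congr rfl fun i _ ↦ Finset.sum_congr rfl fun j _ ↦ ?_
  rw [Finset.mul_sum]
  exact Finset.sum_congr rfl fun d _ ↦ by rw [Finset.mul_sum]

/-- **Separation of the joint moments (signed form)**: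
`J_s(k₁,k₂) = Σ_{t≤s} C(s,t)(−1)^{s−t}·M_t(k₁)·M_{s−t}(k₂)`, `M_t(k) = Σ_{d∣k}(2log d − log k)^t` (binomial theorem in
`δ = s_{k₁}(d) − s_{k₂}(e)`; every `k₁, k₂, s`). [folklore] -/
theorem sum_divisors_sum_divisors_delta_pow (s k₁ k₂ : ℕ) :
    ∑ d ∈ k₁.divisors, ∑ e ∈ k₂.divisors,
        ((2 * Real.log d - Real.log k₁) - (2 * Real.log e - Real.log k₂)) ^ s =
      ∑ t ∈ range (s + 1), (s.choose t : ℝ) * (-1) ^ (s - t) *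
        ((∑ d ∈ k₁.divisors, (2 * Real.log d - Real.log k₁) ^ t) *
          ∑ e ∈ k₂.divisors, (2 * Real.log e - Real.log k₂) ^ (s - t)) := by
  have hpt : ∀ d e : ℕ, ((2 * Real.log d - Real.log k₁) - (2 * Real.log e - Real.log k₂)) ^ s =
      ∑ t ∈ range (s + 1), (s.choose t : ℝ) * (-1) ^ (s - t) *
        ((2 * Real.log d - Real.log k₁) ^ t * (2 * Real.log e - Real.log k₂) ^ (s - t)) := by
    intro d e
    rw [sub_eq_add_neg, add_pow]
    refine Finset.sum_congr rfl fun t _ ↦ ?_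
    rw [neg_pow]
    ring
  simp_rw [hpt]
  rw [sum_sum_sum_comm]
  refine Finset.sum_congr rfl fun t _ ↦ ?_
  rw [Finset.sum_mul_sum, Finset.mul_sum]
  exact Finset.sum_congr rfl fun d _ ↦ by rw [Finset.mul_sum]

/-- `(−1)^u·M_u(k) = M_u(k)` (both vanish for odd `u`). [folklore] -/
theorem neg_one_pow_mul_centralMoment (u k : ℕ) :
    (-1 : ℝ) ^ u * ∑ d ∈ k.divisors, (2 * Real.log d - Real.log k) ^ u =
      ∑ d ∈ k.divisors, (2 * Real.log d - Real.log k) ^ u := by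
  rcases Nat.even_or_odd u with hu | hu
  · rw [hu.neg_one_pow, one_mul]
  · rw [centralMoment_eq_zero_of_odd hu, mul_zero]

/-- **Separation of the joint moments**: `J_s(k₁,k₂) = Σ_{t≤s} C(s,t)·M_t(k₁)·M_{s−t}(k₂)` (every `k₁, k₂, s`).
[folklore] -/
theorem sum_divisors_sum_divisors_delta_pow_eq (s k₁ k₂ : ℕ) :
    ∑ d ∈ k₁.divisors, ∑ e ∈ k₂.divisors,
        ((2 * Real.log d - Real.log k₁) - (2 * Real.log e - Real.log k₂)) ^ s =
      ∑ t ∈ range (s + 1), (s.choose t : ℝ) *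
        ((∑ d ∈ k₁.divisors, (2 * Real.log d - Real.log k₁) ^ t) *
          ∑ e ∈ k₂.divisors, (2 * Real.log e - Real.log k₂) ^ (s - t)) := by
  rw [sum_divisors_sum_divisors_delta_pow]
  refine Finset.sum_congr rfl fun t _ ↦ ?_
  linear_combination ((s.choose t : ℝ) * ∑ d ∈ k₁.divisors, (2 * Real.log d - Real.log k₁) ^ t) *
    neg_one_pow_mul_centralMoment (s - t) k₂

/-- **`J_s(k₁,k₂) = 0` for odd `s`** (in each term `t` or `s − t` is odd). [folklore] -/
theorem sum_divisors_sum_divisors_delta_pow_eq_zero_of_odd {s : ℕ} (hs : Odd s) (k₁ k₂ : ℕ) :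
    ∑ d ∈ k₁.divisors, ∑ e ∈ k₂.divisors,
        ((2 * Real.log d - Real.log k₁) - (2 * Real.log e - Real.log k₂)) ^ s = 0 := by
  rw [sum_divisors_sum_divisors_delta_pow_eq]
  refine Finset.sum_eq_zero fun t ht ↦ ?_
  have hts : t ≤ s := Nat.lt_succ_iff.1 (Finset.mem_range.1 ht)
  rcases Nat.even_or_odd t with hte | hto
  · have hodd : Odd (s - t) := (Nat.odd_sub hts).2 (iff_of_true hs hte)
    rw [centralMoment_eq_zero_of_odd hodd k₂, mul_zero, mul_zero]
  · rw [centralMoment_eq_zero_of_odd hto k₁, zero_mul, mul_zero]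

/-- **The generic weight algebra in separable closed form:
`Σ_{d∣k₁}Σ_{e∣k₂} A₁^p A₂^q = 2^{−(p+q)} Σ_{i≤p}Σ_{j≤q} C(p,i)C(q,j)(−1)^j L^{(p−i)+(q−j)} Σ_{t≤i+j} C(i+j,t)·M_t(k₁)·M_{i+j−t}(k₂)`**
with `A₁ = X − log e − log(k₁/d)`, `A₂ = X − log d − log(k₂/e)`, `L = 2X − log k₁ − log k₂`,
`M_t(k) = Σ_{d∣k}(2log d − log k)^t` (every `k₁, k₂, p, q`). Only even `t`, `i+j−t` contribute (`M_odd = 0`); on squarefree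
`k`: `M_0 = τ`, `M_2 = τP₂`. [cite: KowalskiMichelVanderKam2000, (23)–(28) — derivation] -/
theorem sum_divisors_sum_divisors_A1_pow_mul_A2_pow_eq (X : ℝ) (p q k₁ k₂ : ℕ) :
    ∑ d ∈ k₁.divisors, ∑ e ∈ k₂.divisors,
        (X - Real.log e - Real.log ((k₁ / d : ℕ) : ℝ)) ^ p * (X - Real.log d - Real.log ((k₂ / e : ℕ) : ℝ)) ^ q =
      (1 / 2) ^ (p + q) * ∑ i ∈ range (p + 1), ∑ j ∈ range (q + 1),
        (p.choose i : ℝ) * (q.choose j) * (-1) ^ j * (2 * X - Real.log k₁ - Real.log k₂) ^ (p - i + (q - j)) *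
          ∑ t ∈ range (i + j + 1), ((i + j).choose t : ℝ) *
            ((∑ d ∈ k₁.divisors, (2 * Real.log d - Real.log k₁) ^ t) *
              ∑ e ∈ k₂.divisors, (2 * Real.log e - Real.log k₂) ^ (i + j - t)) := by
  rw [sum_divisors_sum_divisors_A1_pow_mul_A2_pow]
  simp_rw [sum_divisors_sum_divisors_delta_pow_eq]

/-! ### With an arbitrary `(d,e)`-free factor `H(n₁n₂)` (the Selberg-form format) -/

/-- **`Σ_{d,e} log(Q/n₁)^p·log(Q/n₂)^q·H(n₁n₂) = [Σ_{d,e}A₁^pA₂^q]·H(g²k₁k₂)`** in separable closed form, with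
`n₁ = (k₁/d)(ge)`, `n₂ = (gd)(k₂/e)`, `X = log Q − log g`, `L = 2X − log k₁ − log k₂` (`Q > 0`, `g ≥ 1`; every
`k₁, k₂, p, q`). [cite: KowalskiMichelVanderKam2000, (23)–(28) — derivation] -/
theorem inner_weight_A1_pow_A2_pow (H : ℕ → ℝ) {Q : ℝ} (hQ : 0 < Q) {g : ℕ} (hg : g ≠ 0) (k₁ k₂ p q : ℕ) :
    ∑ d ∈ k₁.divisors, ∑ e ∈ k₂.divisors,
        Real.log (Q / ((k₁ / d * (g * e) : ℕ) : ℝ)) ^ p * Real.log (Q / ((g * d * (k₂ / e) : ℕ) : ℝ)) ^ q *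
          H (k₁ / d * (g * e) * (g * d * (k₂ / e))) =
      ((1 / 2) ^ (p + q) * ∑ i ∈ range (p + 1), ∑ j ∈ range (q + 1),
        (p.choose i : ℝ) * (q.choose j) * (-1) ^ j *
            (2 * (Real.log Q - Real.log g) - Real.log k₁ - Real.log k₂) ^ (p - i + (q - j)) *
          ∑ t ∈ range (i + j + 1), ((i + j).choose t : ℝ) *
            ((∑ d ∈ k₁.divisors, (2 * Real.log d - Real.log k₁) ^ t) *
              ∑ e ∈ k₂.divisors, (2 * Real.log e - Real.log k₂) ^ (i + j - t))) *
        H (g * g * (k₁ * k₂)) := by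
  rw [Finset.sum_congr rfl fun d hd ↦ Finset.sum_congr rfl fun e he ↦ by
    rw [n1_mul_n2_eq g hd he, log_Q_div_n1_eq hQ hg hd he, log_Q_div_n2_eq hQ hg hd he]]
  simp_rw [← Finset.sum_mul]
  rw [sum_divisors_sum_divisors_A1_pow_mul_A2_pow_eq]

/-! ### Checks: `(p,q) = (2,0)` and `(1,1)` on squarefree numbers -/

/-- **`Σ_{d∣k₁}Σ_{e∣k₂} A₁² = τ(k₁)τ(k₂)·(L²/4 + (P₂(k₁) + P₂(k₂))/4)`** for squarefree `k₁, k₂` (the `(2,0)` instance: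
`J₀ = ττ`, `J₁ = 0`, `J₂ = ττ(P₂(k₁)+P₂(k₂))`). [cite: KowalskiMichelVanderKam2000, (23)–(28) — derivation] -/
theorem sum_divisors_sum_divisors_A1_sq_of_squarefree (X : ℝ) {k₁ k₂ : ℕ} (hk₁ : Squarefree k₁)
    (hk₂ : Squarefree k₂) :
    ∑ d ∈ k₁.divisors, ∑ e ∈ k₂.divisors, (X - Real.log e - Real.log ((k₁ / d : ℕ) : ℝ)) ^ 2 =
      (k₁.divisors.card : ℝ) * (k₂.divisors.card : ℝ) *
        ((2 * X - Real.log k₁ - Real.log k₂) ^ 2 / 4 +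
          ((∑ p ∈ k₁.primeFactors, Real.log p ^ 2) + ∑ p ∈ k₂.primeFactors, Real.log p ^ 2) / 4) := by
  have h := sum_divisors_sum_divisors_A1_pow_mul_A2_pow_eq X 2 0 k₁ k₂
  have hL : ∑ d ∈ k₁.divisors, ∑ e ∈ k₂.divisors, (X - Real.log e - Real.log ((k₁ / d : ℕ) : ℝ)) ^ 2 =
      ∑ d ∈ k₁.divisors, ∑ e ∈ k₂.divisors,
        (X - Real.log e - Real.log ((k₁ / d : ℕ) : ℝ)) ^ 2 * (X - Real.log d - Real.log ((k₂ / e : ℕ) : ℝ)) ^ 0 := by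
    simp only [pow_zero, mul_one]
  rw [hL, h]
  simp only [Finset.sum_range_succ, Finset.sum_range_zero, zero_add, Nat.sub_self, Nat.sub_zero,
    centralMoment_zero, centralMoment_one,
    centralMoment_two_of_squarefree hk₁, centralMoment_two_of_squarefree hk₂]
  push_cast
  norm_num [Nat.choose]
  ring

-- Consistency check with `…DiagDecorWeightOneOne.sum_divisors_sum_divisors_A1_mul_A2_of_squarefree` (landed):
-- the `(1,1)` instance of the generic formula re-derives `Σ_{d,e}A₁A₂ = τ(k₁)τ(k₂)·(L²/4 − (P₂(k₁)+P₂(k₂))/4)`.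
example (X : ℝ) {k₁ k₂ : ℕ} (hk₁ : Squarefree k₁) (hk₂ : Squarefree k₂) :
    ∑ d ∈ k₁.divisors, ∑ e ∈ k₂.divisors,
        (X - Real.log e - Real.log ((k₁ / d : ℕ) : ℝ)) * (X - Real.log d - Real.log ((k₂ / e : ℕ) : ℝ)) =
      (k₁.divisors.card : ℝ) * (k₂.divisors.card : ℝ) *
        ((2 * X - Real.log k₁ - Real.log k₂) ^ 2 / 4 -
          ((∑ p ∈ k₁.primeFactors, Real.log p ^ 2) + ∑ p ∈ k₂.primeFactors, Real.log p ^ 2) / 4) := by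
  have h := sum_divisors_sum_divisors_A1_pow_mul_A2_pow_eq X 1 1 k₁ k₂
  have hL : ∑ d ∈ k₁.divisors, ∑ e ∈ k₂.divisors,
      (X - Real.log e - Real.log ((k₁ / d : ℕ) : ℝ)) * (X - Real.log d - Real.log ((k₂ / e : ℕ) : ℝ)) =
      ∑ d ∈ k₁.divisors, ∑ e ∈ k₂.divisors,
        (X - Real.log e - Real.log ((k₁ / d : ℕ) : ℝ)) ^ 1 * (X - Real.log d - Real.log ((k₂ / e : ℕ) : ℝ)) ^ 1 := by
    simp only [pow_one]
  rw [hL, h]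
  simp only [Finset.sum_range_succ, Finset.sum_range_zero, zero_add, Nat.sub_self, Nat.sub_zero,
    centralMoment_zero, centralMoment_one,
    centralMoment_two_of_squarefree hk₁, centralMoment_two_of_squarefree hk₂]
  push_cast
  norm_num [Nat.choose]
  ring

end Summit.Parity.GeneralizedHardyLittlewood.Theorems.MomentsBeyondDiagonal.DiagKernel

end
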